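import Mathlib
import HarnessLib
import Summits.HubbardSuperconductivity.HubbardSuperconductivity.Theorems.KLProgrammeKLRegimeSplitEdgeFactsBandJets

/-!
# Route `KLProgramme` — edge facts for the pair masses ACROSS TRANSFERS, XV: a LEVEL-SET FLOOR on the torus grid from CROSSING COLUMNS —
# `#{k⃗ : A ≤ e_K(p_k⃗) ≤ B} ≥ #C·((B − A)·L/(2π(4 + coeffNorm 1 K)) − 1)` for every set `C` of grid columns along which the band passes from below `A` to above `B`
# (the momentum half of the layer count behind the pinned floor (D3′); the tree has only UPPER level counts)

Cell gate-hubbard-kl, seat hubbard-kl-k3c1-p1 (g21; child-1 lineage).  `…PinnedFloorCompl` reduces the per-step pinned floor of the complementary members to a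
LAYER COUNT, and its §4 to a Matsubara window count (`…MatsubaraWindowCount`) times a LEVEL-SET FLOOR `#{k⃗ : A ≤ e_K(p_k⃗) ≤ B}` on the momentum grid.  THIS FILE proves such a
floor from the only robust geometric input — columns of the grid `(ℤ/Lℤ)²` along which `e_K` takes a value `< A` and a value `> B`:

* §1 **`kllf_window_count_ge`** (discrete crossing count): a real sequence with increments `≤ δ` from below `A` (time `0`) to above `B` (time `T`) takes at least
  `(B − A)/δ − 1` values in `[A, B]` at times `0 < i < T`;
* §2 the grid: the band moves by at most `δ = (4 + coeffNorm 1 K)·2π/L` between vertical neighbours (`…BandJets`), so along the column `k⃗₀ = a` from a point below `A`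
  to a point above `B`: **`kllf_column_window_card_ge`** `#{k⃗ : k⃗₀ = a, A ≤ e_K ≤ B} ≥ (B − A)·L/(2π(4 + coeffNorm 1 K)) − 1`, and summing over a set `C` of such columns
  **`kllf_levelSet_card_ge`** `#{k⃗ : A ≤ e_K(p_k⃗) ≤ B} ≥ #C·((B − A)·L/(2π(4 + coeffNorm 1 K)) − 1)`.

For the band of record E1 exhibits `C` from the μ-window (e.g. `−2cos(2πa/L) − 2 − μ + sup|K| < A` and `−2cos(2πa/L) + 2 − μ − sup|K| > B`, a positive fraction of the
`L` columns), giving the Fermi-curve-length floor `≳ (B − A)·L²`.  Pure counting + row 20; no definitions; nothing asserts any slot, stub, K3 or SC. [folklore]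
-/

noncomputable section

namespace Summit.HubbardSuperconductivity.HubbardSuperconductivity.Theorems.KLRegimeSplit

set_option linter.dupNamespace false -- summit = problem name (single-conjunct summit), D-0017

open Real Finset Literature.MathematicalPhysics.QuantumLattice Literature.Probability.LatticeModels
open Summit.HubbardSuperconductivity.HubbardSuperconductivity.Theorems.KLProgrammeLegKernels

/-! ## §1 The discrete crossing count -/

/-- **Discrete crossing count**: a real sequence with increments `≤ δ` (`0 < δ`) that is below `A` at time `0` and above `B` at time `T` (`A ≤ B`) takes at least
`(B − A)/δ − 1` values in `[A, B]` at times `0 < i < T` (counted here among `i < T`). [folklore] -/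
theorem kllf_window_count_ge (f : ℕ → ℝ) {A B δ : ℝ} (hAB : A ≤ B) (hδ : 0 < δ) (T : ℕ) (h0 : f 0 < A) (hT : B < f T)
    (hstep : ∀ i < T, |f (i + 1) - f i| ≤ δ) :
    (B - A) / δ - 1 ≤ (((range T).filter fun i => A ≤ f i ∧ f i ≤ B).card : ℝ) := by
  classical
  -- the last index `i₀ ≤ T` below `A`
  set Sb := (range (T + 1)).filter fun i => f i < A with hSb
  have hSb0 : 0 ∈ Sb := by rw [hSb, mem_filter]; exact ⟨mem_range.2 (by omega), h0⟩
  have hSbne : Sb.Nonempty := ⟨0, hSb0⟩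
  set i₀ := Sb.max' hSbne with hi₀
  have hi₀mem : i₀ ∈ Sb := Sb.max'_mem hSbne
  have hi₀T : i₀ ≤ T := by have := (mem_filter.1 hi₀mem).1; rw [mem_range] at this; omega
  have hfi₀ : f i₀ < A := (mem_filter.1 hi₀mem).2
  have hi₀lt : i₀ < T := by
    rcases Nat.lt_or_ge i₀ T with h | h
    · exact h
    · have : i₀ = T := le_antisymm hi₀T h
      rw [this] at hfi₀; linarith
  have habove : ∀ i, i₀ < i → i ≤ T → A ≤ f i := by
    intro i hi hiT
    by_contra hlt
    push Not at hlt
    have hmem : i ∈ Sb := by rw [hSb, mem_filter]; exact ⟨mem_range.2 (by omega), hlt⟩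
    have := Sb.le_max' i hmem
    rw [← hi₀] at this
    omega
  -- the first index after `i₀` above `B`
  set Sa := (range (T + 1)).filter fun i => i₀ < i ∧ B < f i with hSa
  have hSaT : T ∈ Sa := by rw [hSa, mem_filter]; exact ⟨mem_range.2 (by omega), hi₀lt, hT⟩
  have hSane : Sa.Nonempty := ⟨T, hSaT⟩
  set i₁ := Sa.min' hSane with hi₁
  have hi₁mem : i₁ ∈ Sa := Sa.min'_mem hSane
  have hi₁T : i₁ ≤ T := by have := (mem_filter.1 hi₁mem).1; rw [mem_range] at this; omega
  have hi₀i₁ : i₀ < i₁ := (mem_filter.1 hi₁mem).2.1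
  have hfi₁ : B < f i₁ := (mem_filter.1 hi₁mem).2.2
  have hbelow : ∀ i, i₀ < i → i < i₁ → f i ≤ B := by
    intro i hi hi'
    by_contra hlt
    push Not at hlt
    have hmem : i ∈ Sa := by rw [hSa, mem_filter]; exact ⟨mem_range.2 (by omega), hi, hlt⟩
    have := Sa.min'_le i hmem
    rw [← hi₁] at this
    omega
  have hsub : Finset.Ioo i₀ i₁ ⊆ (range T).filter fun i => A ≤ f i ∧ f i ≤ B := by
    intro i hi
    rw [Finset.mem_Ioo] at hi
    rw [mem_filter, mem_range]
    exact ⟨by omega, habove i hi.1 (by omega), hbelow i hi.1 hi.2⟩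
  have hcard : ((i₁ - i₀ - 1 : ℕ) : ℝ) ≤ (((range T).filter fun i => A ≤ f i ∧ f i ≤ B).card : ℝ) := by
    have := Finset.card_le_card hsub
    rw [Nat.card_Ioo] at this
    exact_mod_cast this
  have hinc : ∀ n : ℕ, i₀ + n ≤ T → f (i₀ + n) - f i₀ ≤ n * δ := by
    intro n
    induction n with
    | zero => intro _; simp
    | succ n ih =>
      intro hn
      have h1 := ih (by omega)
      have h2 := hstep (i₀ + n) (by omega)
      have h3 := (abs_le.1 h2).2
      rw [show i₀ + (n + 1) = i₀ + n + 1 by ring]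
      push_cast
      linarith
  have hgap : f i₁ - f i₀ ≤ ((i₁ - i₀ : ℕ) : ℝ) * δ := by
    have := hinc (i₁ - i₀) (by omega)
    rwa [show i₀ + (i₁ - i₀) = i₁ by omega] at this
  have hdiff : B - A < ((i₁ - i₀ : ℕ) : ℝ) * δ := by linarith
  have hq : (B - A) / δ < ((i₁ - i₀ : ℕ) : ℝ) := by rw [div_lt_iff₀ hδ]; exact hdiff
  have hnat : ((i₁ - i₀ - 1 : ℕ) : ℝ) = ((i₁ - i₀ : ℕ) : ℝ) - 1 := by
    rw [Nat.cast_sub (by omega)]; push_cast; ring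
  linarith [hcard, hnat ▸ hcard]

/-! ## §2 Columns of the momentum grid -/

section Grid

variable {L : ℕ} [NeZero L] (μ : ℝ) (K : TrigPolyC4v)

omit [NeZero L] in
/-- The point `t` steps up the column `a` from height `b`: `(a, b + t)`. [folklore] -/
theorem kllf_colPt_succ (a b : ZMod L) (t : ℕ) :
    (![a, b + ((t + 1 : ℕ) : ZMod L)] : TorusSite 2 L) = ![a, b + (t : ZMod L)] + Pi.single 1 1 := by
  ext i
  fin_cases i
  · simp
  · simp [add_assoc]

/-- **The vertical step of the band**: `|e_K(a, b+1) − e_K(a, b)| ≤ (4 + coeffNorm 1 K)·2π/L` (row 20 at the step `Q = e₂`, `|p_{e₂}|_𝕋 ≤ 2π/L`). [folklore] -/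
theorem kllf_abs_nambuXiCT_step_le (k : TorusSite 2 L) :
    |nambuXiCT L μ K (k + Pi.single 1 1) - nambuXiCT L μ K k| ≤ (4 + K.coeffNorm 1) * (2 * π / L) := by
  have h := klbj_abs_nambuXiCT_add_sub_le μ K k (Pi.single 1 1)
  have hv : 0 ≤ 4 + K.coeffNorm 1 := by have := TrigPolyC4v.coeffNorm_nonneg 1 K; linarith
  refine h.trans (mul_le_mul_of_nonneg_left ?_ hv)
  -- `|p_{e₂}|_𝕋 = max(|0|_𝕋, |2π·val 1/L|_𝕋) ≤ 2π/L`
  have hL : (0 : ℝ) < L := by exact_mod_cast Nat.pos_of_ne_zero (NeZero.ne L)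
  have h1 : ((1 : ZMod L).val : ℝ) ≤ 1 := by
    have := ZMod.val_one_eq_one_mod L
    have h2 : (1 : ZMod L).val ≤ 1 := by rw [this]; exact Nat.mod_le 1 L
    exact_mod_cast h2
  unfold klTorusNorm KLProgrammeLegKernels.torusSupNorm
  refine max_le ?_ ?_
  · simp only [latticeMomentum, Pi.single_eq_of_ne (show (0 : Fin 2) ≠ 1 by decide), ZMod.val_zero, Nat.cast_zero, mul_zero, zero_div]
    rw [klvc_torusAbs_zero]; positivity
  · simp only [latticeMomentum, Pi.single_eq_same]
    refine (klvc_torusAbs_le_abs _).trans ?_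
    rw [abs_of_nonneg (by positivity)]
    calc 2 * π * ((1 : ZMod L).val : ℝ) / L ≤ 2 * π * 1 / L := by gcongr
      _ = 2 * π / L := by ring

/-- **Window count along one crossing column**: if the column `k⃗₀ = a` contains a point with `e_K < A` and a point with `B < e_K` (`A ≤ B`), then
`(B − A)·L/(2π(4 + coeffNorm 1 K)) − 1 ≤ #{k⃗ : k⃗₀ = a ∧ A ≤ e_K(p_k⃗) ≤ B}`. [folklore] -/
theorem kllf_column_window_card_ge {A B : ℝ} (hAB : A ≤ B) (a : ZMod L) {klo khi : TorusSite 2 L} (hklo : klo 0 = a) (hkhi : khi 0 = a)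
    (hlo : nambuXiCT L μ K klo < A) (hhi : B < nambuXiCT L μ K khi) :
    (B - A) * L / (2 * π * (4 + K.coeffNorm 1)) - 1 ≤
      (((univ : Finset (TorusSite 2 L)).filter fun k => k 0 = a ∧ (A ≤ nambuXiCT L μ K k ∧ nambuXiCT L μ K k ≤ B)).card : ℝ) := by
  classical
  have hL : (0 : ℝ) < L := by exact_mod_cast Nat.pos_of_ne_zero (NeZero.ne L)
  have hv : 0 < 4 + K.coeffNorm 1 := by have := TrigPolyC4v.coeffNorm_nonneg 1 K; linarith
  set δ := (4 + K.coeffNorm 1) * (2 * π / L) with hδ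
  have hδ0 : 0 < δ := by positivity
  -- the column path from `klo`
  set b := klo 1 with hb
  set f : ℕ → ℝ := fun t => nambuXiCT L μ K ![a, b + (t : ZMod L)] with hf
  have hkloeq : klo = ![a, b + ((0 : ℕ) : ZMod L)] := by
    ext i; fin_cases i
    · simp [hklo]
    · simp [hb]
  set T := (khi 1 - b).val with hT
  have hTlt : T < L := ZMod.val_lt _
  have hkhieq : khi = ![a, b + ((T : ℕ) : ZMod L)] := by
    ext i; fin_cases i
    · simp [hkhi]
    · simp [hT]
  have h0 : f 0 < A := by simp only [hf]; rw [← hkloeq]; exact hlo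
  have hTB : B < f T := by simp only [hf]; rw [← hkhieq]; exact hhi
  have hstep : ∀ i < T, |f (i + 1) - f i| ≤ δ := fun i _ => by
    simp only [hf]
    rw [kllf_colPt_succ]
    exact kllf_abs_nambuXiCT_step_le μ K _
  have hcount := kllf_window_count_ge f hAB hδ0 T h0 hTB hstep
  -- the window times inject into the column window set
  set W := (univ : Finset (TorusSite 2 L)).filter fun k => k 0 = a ∧ (A ≤ nambuXiCT L μ K k ∧ nambuXiCT L μ K k ≤ B) with hW
  set ι : ℕ → TorusSite 2 L := fun t => ![a, b + (t : ZMod L)] with hι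
  have hinj : Set.InjOn ι ((range T).filter fun i => A ≤ f i ∧ f i ≤ B : Finset ℕ) := by
    intro t ht t' ht' h
    have htT : t < T := mem_range.1 (mem_filter.1 ht).1
    have ht'T : t' < T := mem_range.1 (mem_filter.1 ht').1
    have h1 : (b + (t : ZMod L)) = b + (t' : ZMod L) := by
      have := congrFun h 1
      simpa [hι] using this
    have h2 : ((t : ZMod L)) = (t' : ZMod L) := add_left_cancel h1
    have h3 := (ZMod.natCast_eq_natCast_iff' t t' L).1 h2
    rw [Nat.mod_eq_of_lt (by omega), Nat.mod_eq_of_lt (by omega)] at h3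
    exact h3
  have himg : ((range T).filter fun i => A ≤ f i ∧ f i ≤ B).image ι ⊆ W := by
    intro k hk
    obtain ⟨t, ht, rfl⟩ := mem_image.1 hk
    obtain ⟨-, h1, h2⟩ := mem_filter.1 ht
    rw [hW, mem_filter]
    exact ⟨mem_univ _, by simp [hι], h1, h2⟩
  have hcardle : ((range T).filter fun i => A ≤ f i ∧ f i ≤ B).card ≤ W.card := by
    rw [← Finset.card_image_of_injOn hinj]
    exact Finset.card_le_card himg
  have hcast : (((range T).filter fun i => A ≤ f i ∧ f i ≤ B).card : ℝ) ≤ (W.card : ℝ) := by exact_mod_cast hcardle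
  have hre : (B - A) * L / (2 * π * (4 + K.coeffNorm 1)) = (B - A) / δ := by
    rw [hδ]; field_simp
  rw [hre]
  exact hcount.trans hcast

/-- **Level-set floor from crossing columns**: for a set `C` of columns each containing a point with `e_K < A` and a point with `B < e_K` (`A ≤ B`),
`#C·((B − A)·L/(2π(4 + coeffNorm 1 K)) − 1) ≤ #{k⃗ : A ≤ e_K(p_k⃗) ≤ B}`. [folklore] -/
theorem kllf_levelSet_card_ge {A B : ℝ} (hAB : A ≤ B) (C : Finset (ZMod L))
    (hC : ∀ a ∈ C, (∃ k : TorusSite 2 L, k 0 = a ∧ nambuXiCT L μ K k < A) ∧ ∃ k : TorusSite 2 L, k 0 = a ∧ B < nambuXiCT L μ K k) :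
    (C.card : ℝ) * ((B - A) * L / (2 * π * (4 + K.coeffNorm 1)) - 1) ≤
      (((univ : Finset (TorusSite 2 L)).filter fun k => A ≤ nambuXiCT L μ K k ∧ nambuXiCT L μ K k ≤ B).card : ℝ) := by
  classical
  set W := (univ : Finset (TorusSite 2 L)).filter fun k => A ≤ nambuXiCT L μ K k ∧ nambuXiCT L μ K k ≤ B with hW
  set WC := W.filter fun k => k 0 ∈ C with hWC
  -- fibrewise decomposition of `WC` over the columns in `C`
  have hfib : WC.card = ∑ a ∈ C, (WC.filter fun k => k 0 = a).card :=
    Finset.card_eq_sum_card_fiberwise fun k hk => by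
      have := (mem_filter.1 (Finset.mem_coe.1 hk)).2
      exact Finset.mem_coe.2 this
  have hcol : ∀ a ∈ C, (WC.filter fun k => k 0 = a) =
      (univ : Finset (TorusSite 2 L)).filter fun k => k 0 = a ∧ (A ≤ nambuXiCT L μ K k ∧ nambuXiCT L μ K k ≤ B) := by
    intro a ha
    ext k
    simp only [hWC, hW, mem_filter, mem_univ, true_and]
    constructor
    · rintro ⟨⟨h1, -⟩, h3⟩; exact ⟨h3, h1⟩
    · rintro ⟨h3, h1⟩; exact ⟨⟨h1, h3 ▸ ha⟩, h3⟩
  have hsum : (C.card : ℝ) * ((B - A) * L / (2 * π * (4 + K.coeffNorm 1)) - 1) ≤ (WC.card : ℝ) := by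
    rw [hfib]
    push_cast
    rw [show (C.card : ℝ) * ((B - A) * L / (2 * π * (4 + K.coeffNorm 1)) - 1) = ∑ a ∈ C, ((B - A) * L / (2 * π * (4 + K.coeffNorm 1)) - 1) by
      rw [Finset.sum_const, nsmul_eq_mul]]
    refine Finset.sum_le_sum fun a ha => ?_
    rw [hcol a ha]
    obtain ⟨⟨klo, hklo, hlo⟩, khi, hkhi, hhi⟩ := hC a ha
    exact kllf_column_window_card_ge μ K hAB a hklo hkhi hlo hhi
  have hle : WC.card ≤ W.card := Finset.card_le_card (Finset.filter_subset _ _)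
  exact hsum.trans (Nat.cast_le.2 hle)

end Grid

end Summit.HubbardSuperconductivity.HubbardSuperconductivity.Theorems.KLRegimeSplit

end
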